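import Mathlib
import HarnessLib
import Summits.QuantumAdvantage.QuantumAdvantage.Theorems.DigitDialB
import Summits.QuantumAdvantage.QuantumAdvantage.Theorems.DigitDialK
import Summits.QuantumAdvantage.AdviceFreeQNC0.HiddenCoinsReduction
import Literature.Computability.MetaComplexity.TwoModuliExpSums

set_option linter.dupNamespace false
set_option autoImplicit false

/-!
# DigitDial (L) — THE MEMORY DIAL: strategies reading ONE chain QUADRATIC form mod ANY `M` lose the u-walk game
# (cell decomp-qadv, lens 4, g20 rev 6)

Prop-definition-free tree twin of §10d–f of the lens-4 g20 node `DigitDial`.  Strategies `y_g(u) = tab_g(Q(u))`,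
`Q(u) = quadChain q l u = Σ_i [u_i]·(l_i + [u_{i-1}]·q_i) ∈ ℤ/M` (a nearest-neighbour quadratic form plus a linear form; ARBITRARY
per-cut tables `tab_g : ℤ/M → Bool`).
* `char_quadChain_eq_prod` (`e_M(j·Q(u))` = product of the memory site phases); `site_contractQ` (+ `rhoQ_sq`, `rhoQ_lt_one`): every
  site with `j q_i ≠ 0` contracts by `ρ_M = ((1+cos(π/M))/2)^{1/2} < 1`; `corr_win_quad_le`: `|Σ_u [WIN_Y(u)]·e_M(j·Q(u))| ≤ 6ρ_M^{#}·2ⁿ`;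
* `card_fibre_win_le_gen` / `card_win_tab_le_of`: character expansion over the fibres of ONE `ℤ/M`-statistic (cf. `DigitDialB`);
* `qStrat_card_win_le`: `#WIN(qStrat q l tab) ≤ (3/4 + 6M·ρ_M^s)·2ⁿ` whenever every non-zero multiple `j·q` has `≥ s` non-zero
  coordinates (`n ≥ 4`) — EVERY modulus `M`, no coprimality to `3`; `qStrat_card_win_le_seven_eighths`: the `7/8` form.  0 sorry.
-/

noncomputable section

namespace Summit.QuantumAdvantage.QuantumAdvantage.Theorems.DigitDial

open Finset Summit.QuantumAdvantage.AdviceFreeQNC0 Literature.Computability.MetaComplexity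
open TwistedTransfer ConstBells

/-! ### 10d. The strategy class: ONE chain quadratic form + linear form mod `M`, arbitrary tables -/

section QuadChain

variable {n : ℕ} {M : ℕ} [NeZero M]

open TwistQ

/-- The chain quadratic form plus linear form mod `M` read by the strategy: `Q(u) = Σ_i [u_i]·(l_i + [u_{i-1}]·q_i)`
(`u_{-1} := 0`; `q_0` is never read). -/
def quadChain (q l : Fin n → ZMod M) (u : Fin n → Bool) : ZMod M :=
  ∑ i : Fin n, if u i then (l i + if prevN false u i.val then q i else 0) else 0

/-- A QUAD-CHAIN STRATEGY: cut `g` fires according to an arbitrary table `tab g : ℤ/M → Bool` read at `Q(u)`. -/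
def qStrat (q l : Fin n → ZMod M) (tab : Fin (n + 1) → ZMod M → Bool) : Fin (n + 1) → (Fin n → Bool) → Bool :=
  fun g u => tab g (quadChain q l u)

/-- The site phases `ζ_i = e_M(j q_i)`, `η_i = e_M(j l_i)` (and `1` beyond the input length). -/
def zetaQ (j : ZMod M) (q : Fin n → ZMod M) (i : ℕ) : ℂ := if h : i < n then (ZMod.stdAddChar (j * q ⟨i, h⟩) : ℂ) else 1

/-- The character of the form is the product of the memory site phases:
`e_M(j·Q(u)) = Π_i qph(ζ_i, η_i, u_i, u_{i-1})`. -/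
theorem char_quadChain_eq_prod (j : ZMod M) (q l : Fin n → ZMod M) (u : Fin n → Bool) :
    (ZMod.stdAddChar (j * quadChain q l u) : ℂ) =
      ∏ i : Fin n, qph (zetaQ j q i.val) (zetaQ j l i.val) (u i) (prevN false u i.val) := by
  unfold quadChain
  rw [Finset.mul_sum]
  have hre : (∑ i : Fin n, j * (if u i then (l i + if prevN false u i.val then q i else 0) else 0)) =
      ∑ i : Fin n, (if u i then j * (l i + if prevN false u i.val then q i else 0) else 0) := by
    refine Finset.sum_congr rfl fun i _ => ?_
    split_ifs <;> simp
  rw [hre, TwoModuli.stdAddChar_sum_ite]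
  refine Finset.prod_congr rfl fun i _ => ?_
  unfold qph zetaQ
  rw [dif_pos i.isLt, dif_pos i.isLt]
  by_cases hu : u i = true
  · rw [if_pos hu, if_pos hu]
    by_cases hp : prevN false u i.val = true
    · rw [if_pos hp, if_pos hp, mul_add, AddChar.map_add_eq_mul, mul_comm]
    · rw [if_neg hp, if_neg hp, add_zero, one_mul]
  · rw [if_neg hu, if_neg hu]

/-- The contraction currency of the memory dial: `ρ_M = ((1 + cos(π/M))/2)^{1/2}` (`= cos(π/(2M))`). -/
def rhoQ (M : ℕ) : ℝ := Real.sqrt ((1 + Real.cos (Real.pi / M)) / 2)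

omit [NeZero M] in
/-- `0 ≤ ρ_M`. -/
theorem rhoQ_nonneg (M : ℕ) : 0 ≤ rhoQ M := Real.sqrt_nonneg _

omit [NeZero M] in
/-- `ρ_M² = (1 + cos(π/M))/2`. -/
theorem rhoQ_sq (M : ℕ) : rhoQ M ^ 2 = (1 + Real.cos (Real.pi / M)) / 2 := by
  unfold rhoQ
  rw [Real.sq_sqrt]
  linarith [Real.neg_one_le_cos (Real.pi / M)]

/-- `ρ_M < 1` for `M ≥ 1`. -/
theorem rhoQ_lt_one (M : ℕ) [NeZero M] : rhoQ M < 1 := by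
  have hM : (1 : ℝ) ≤ M := by exact_mod_cast Nat.one_le_iff_ne_zero.2 (NeZero.ne M)
  have hc : Real.cos (Real.pi / M) < 1 := by
    rw [← Real.cos_zero]
    apply Real.cos_lt_cos_of_nonneg_of_le_pi (le_refl 0)
    · rw [div_le_iff₀ (by positivity)]; nlinarith [Real.pi_pos]
    · positivity
  have h2 : rhoQ M ^ 2 < 1 := by rw [rhoQ_sq]; linarith
  nlinarith [rhoQ_nonneg M]

/-- The per-site contraction factors of the phase vector `j·q`. -/
def siteRhoQ (j : ZMod M) (q : Fin n → ZMod M) (i : ℕ) : ℝ :=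
  if h : i < n then (if j * q ⟨i, h⟩ = 0 then 1 else rhoQ M) else 1

/-- **Every site contracts by its factor** (`key_ineq` with `λ = cos(π/M)` at the sites with `j q_i ≠ 0`, `λ = 1` elsewhere). -/
theorem site_contractQ (j : ZMod M) (q l : Fin n → ZMod M) (g : ℕ) (v : ZMod 3 → Bool → ℂ) :
    cnsq2 (twAvg2 (zetaQ j q g) (zetaQ j l g) v) ≤ siteRhoQ j q g ^ 2 * cnsq2 v := by
  have hnorm1 : ∀ a : ZMod M, ‖(ZMod.stdAddChar a : ℂ)‖ ≤ 1 := fun a => by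
    rw [ZMod.stdAddChar_apply, Circle.norm_coe]
  have htriv : ∀ ζ η : ℂ, ‖η‖ ≤ 1 → ‖ζ‖ ≤ 1 → cnsq2 (twAvg2 ζ η v) ≤ 1 ^ 2 * cnsq2 v := by
    intro ζ η hη hζ
    have hl : ‖1 + ζ‖ ≤ 2 * 1 := by
      calc ‖1 + ζ‖ ≤ ‖(1 : ℂ)‖ + ‖ζ‖ := norm_add_le _ _
        _ ≤ 2 * 1 := by rw [norm_one]; linarith
    have := cnsq2_twAvg2_le hη hζ hl v
    linarith
  unfold siteRhoQ zetaQ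
  by_cases hg : g < n
  · rw [dif_pos hg, dif_pos hg, dif_pos hg]
    by_cases h0 : j * q ⟨g, hg⟩ = 0
    · rw [if_pos h0]
      exact htriv _ _ (hnorm1 _) (hnorm1 _)
    · rw [if_neg h0, rhoQ_sq]
      exact cnsq2_twAvg2_le (hnorm1 _) (hnorm1 _) (TwoModuli.norm_one_add_stdAddChar_le h0) v
  · rw [dif_neg hg, dif_neg hg, dif_neg hg]
    exact htriv 1 1 (by simp) (by simp)

omit [NeZero M] in
/-- `Π_{i<n} siteRhoQ² = (ρ_M²)^{#{i : j q_i ≠ 0}}`. -/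
theorem prod_siteRhoQ_sq [NeZero M] (j : ZMod M) (q : Fin n → ZMod M) :
    (∏ i ∈ range n, siteRhoQ j q (0 + i) ^ 2) = (rhoQ M ^ 2) ^ (univ.filter fun i : Fin n => j * q i ≠ 0).card := by
  classical
  simp only [zero_add]
  rw [← Fin.prod_univ_eq_prod_range (fun i => siteRhoQ j q i ^ 2) n]
  have h : ∀ i : Fin n, siteRhoQ j q i.val ^ 2 = if j * q i ≠ 0 then rhoQ M ^ 2 else 1 := by
    intro i
    unfold siteRhoQ
    rw [dif_pos i.isLt]
    by_cases hb : j * q i = 0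
    · rw [if_pos hb, if_neg (not_not.2 hb), one_pow]
    · rw [if_neg hb, if_pos hb]
  rw [Finset.prod_congr rfl (fun i _ => h i), Finset.prod_ite, Finset.prod_const, Finset.prod_const_one, mul_one]

/-- The twisted sum `Σ_u sgnU(u)·e_M(j Q(u))` of a constant strategy `B` in memory-transfer form. -/
theorem sum_sgnU_qchar (c : ℕ) (B : Finset (Fin (n + 1))) (j : ZMod M) (q l : Fin n → ZMod M) :
    (∑ u : Fin n → Bool, (sgnU c B u : ℂ) * ∏ i : Fin n, qph (zetaQ j q i.val) (zetaQ j l i.val) (u i) (prevN false u i.val)) =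
      ∑ τ : ZMod 3, (2 : ℂ) ^ n * TBV2 (zetaQ j q) (zetaQ j l) (fT (bellsN B) n (((c + 2 * n : ℕ) : ZMod 3)) τ) 0 n 0 false := by
  have h : ∀ u : Fin n → Bool, (sgnU c B u : ℂ) * ∏ i : Fin n, qph (zetaQ j q i.val) (zetaQ j l i.val) (u i) (prevN false u i.val) =
      ∑ τ : ZMod 3, ((∏ j' ∈ range (n + 1), fT (bellsN B) n (((c + 2 * n : ℕ) : ZMod 3)) τ (0 + j')
        (0 + ((j' + wtPrefix u j' : ℕ) : ZMod 3)) : ℝ) : ℂ) *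
        ∏ i : Fin n, qph (zetaQ j q (0 + i.val)) (zetaQ j l (0 + i.val)) (u i) (prevN false u i.val) := by
    intro u
    rw [sgnU_eq_sum, Complex.ofReal_sum, Finset.sum_mul]
    simp only [zero_add]
    rfl
  simp_rw [h]
  rw [Finset.sum_comm]
  refine Finset.sum_congr rfl fun τ _ => ?_
  exact pathSum_eq (zetaQ j q) (zetaQ j l) _ n 0 0 false

/-- The bound on one memory transfer vector: `|TBV2_0(0, false)| ≤ 2·ρ_M^{#{i : j q_i ≠ 0}}`. -/
theorem norm_TBV2_le (j : ZMod M) (q l : Fin n → ZMod M) (BN : Finset ℕ) (κ τ : ZMod 3) :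
    ‖TBV2 (zetaQ j q) (zetaQ j l) (fT BN n κ τ) 0 n 0 false‖ ≤ 2 * rhoQ M ^ (univ.filter fun i : Fin n => j * q i ≠ 0).card := by
  set s := (univ.filter fun i : Fin n => j * q i ≠ 0).card
  have h1 := cnsq2_TBV2_le (zetaQ j q) (zetaQ j l) (fT BN n κ τ) (fT_sq_le BN n κ τ) (siteRhoQ j q)
    (fun g v => site_contractQ j q l g v) n 0
  rw [prod_siteRhoQ_sq, zero_add] at h1
  have h2 : cnsq2 (TBV2 (zetaQ j q) (zetaQ j l) (fT BN n κ τ) 0 n) ≤ (rhoQ M ^ 2) ^ s * 2 := by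
    refine h1.trans ?_
    exact mul_le_mul_of_nonneg_left (cnsq2_TBV2_zero_le _ _ BN n κ τ) (by positivity)
  have h3 : ‖TBV2 (zetaQ j q) (zetaQ j l) (fT BN n κ τ) 0 n 0 false‖ ^ 2 ≤ (2 * rhoQ M ^ s) ^ 2 := by
    have h4 := (normSq_le_cnsq2 _ 0 false).trans h2
    have h5 : (rhoQ M ^ 2) ^ s = (rhoQ M ^ s) ^ 2 := by rw [← pow_mul, mul_comm, pow_mul]
    rw [h5] at h4
    nlinarith [sq_nonneg (rhoQ M ^ s)]
  have hρ0 := rhoQ_nonneg M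
  have h4 := abs_le_of_sq_le_sq h3 (by positivity)
  rwa [abs_norm] at h4

/-- The twisted sum of a constant strategy is small: `|Σ_u sgnU(u) e_M(j Q(u))| ≤ 6·ρ_M^{s}·2ⁿ`. -/
theorem norm_sum_sgnU_qchar_le (c : ℕ) (B : Finset (Fin (n + 1))) (j : ZMod M) (q l : Fin n → ZMod M) :
    ‖∑ u : Fin n → Bool, (sgnU c B u : ℂ) * ∏ i : Fin n, qph (zetaQ j q i.val) (zetaQ j l i.val) (u i) (prevN false u i.val)‖ ≤
      6 * rhoQ M ^ (univ.filter fun i : Fin n => j * q i ≠ 0).card * (2 : ℝ) ^ n := by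
  rw [sum_sgnU_qchar]
  set s := (univ.filter fun i : Fin n => j * q i ≠ 0).card
  set κ : ZMod 3 := ((c + 2 * n : ℕ) : ZMod 3)
  have hτ : ∀ τ : ZMod 3, ‖(2 : ℂ) ^ n * TBV2 (zetaQ j q) (zetaQ j l) (fT (bellsN B) n κ τ) 0 n 0 false‖ ≤
      (2 : ℝ) ^ n * (2 * rhoQ M ^ s) := by
    intro τ
    rw [norm_mul, norm_pow, Complex.norm_ofNat]
    exact mul_le_mul_of_nonneg_left (norm_TBV2_le j q l _ κ τ) (by positivity)
  have h3 : (∑ τ : ZMod 3, ‖(2 : ℂ) ^ n * TBV2 (zetaQ j q) (zetaQ j l) (fT (bellsN B) n κ τ) 0 n 0 false‖) =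
      ‖(2 : ℂ) ^ n * TBV2 (zetaQ j q) (zetaQ j l) (fT (bellsN B) n κ 0) 0 n 0 false‖ +
      ‖(2 : ℂ) ^ n * TBV2 (zetaQ j q) (zetaQ j l) (fT (bellsN B) n κ 1) 0 n 0 false‖ +
      ‖(2 : ℂ) ^ n * TBV2 (zetaQ j q) (zetaQ j l) (fT (bellsN B) n κ 2) 0 n 0 false‖ :=
    Fin.sum_univ_three _
  refine (norm_sum_le _ _).trans ?_
  rw [h3]
  have t0 := hτ 0; have t1 := hτ 1; have t2 := hτ 2
  linarith

/-- **Correlation bound of the memory dial**: for every oblivious firing set `Y`, charge `c`, `j ∈ ℤ/M` and coefficient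
vectors `q, l`, `|Σ_u [WIN_Y(u)]·e_M(j·Q(u))| ≤ 6·ρ_M^{#{i : j q_i ≠ 0}}·2ⁿ` — for EVERY modulus `M`. -/
theorem corr_win_quad_le (c : ℕ) (Y : Finset (Fin (n + 1))) (j : ZMod M) (q l : Fin n → ZMod M) :
    ‖∑ u : Fin n → Bool, (if ringWinU c (fun g _ => decide (g ∈ Y)) u = true then (1 : ℂ) else 0) *
        (ZMod.stdAddChar (j * quadChain q l u) : ℂ)‖ ≤
      6 * rhoQ M ^ (univ.filter fun i : Fin n => j * q i ≠ 0).card * (2 : ℝ) ^ n := by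
  set s := (univ.filter fun i : Fin n => j * q i ≠ 0).card with hs
  set P : (Fin n → Bool) → ℂ := fun u => ∏ i : Fin n, qph (zetaQ j q i.val) (zetaQ j l i.val) (u i) (prevN false u i.val)
  have hterm : ∀ u : Fin n → Bool, (if ringWinU c (fun g _ => decide (g ∈ Y)) u = true then (1 : ℂ) else 0) *
      (ZMod.stdAddChar (j * quadChain q l u) : ℂ) =
      (1 / 2) * ((sgnU c (∅ : Finset (Fin (n + 1))) u : ℂ) * P u) - (1 / 2) * ((sgnU c Y u : ℂ) * P u) := by
    intro u
    rw [win_indicator_eq, char_quadChain_eq_prod, sgnU_empty]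
    push_cast; ring
  simp_rw [hterm]
  rw [Finset.sum_sub_distrib, ← Finset.mul_sum, ← Finset.mul_sum]
  have hA := norm_sum_sgnU_qchar_le c (∅ : Finset (Fin (n + 1))) j q l
  have hB := norm_sum_sgnU_qchar_le c Y j q l
  calc ‖(1 / 2 : ℂ) * (∑ u : Fin n → Bool, (sgnU c (∅ : Finset (Fin (n + 1))) u : ℂ) * P u) -
        (1 / 2 : ℂ) * (∑ u : Fin n → Bool, (sgnU c Y u : ℂ) * P u)‖
      ≤ ‖(1 / 2 : ℂ) * (∑ u : Fin n → Bool, (sgnU c (∅ : Finset (Fin (n + 1))) u : ℂ) * P u)‖ +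
        ‖(1 / 2 : ℂ) * (∑ u : Fin n → Bool, (sgnU c Y u : ℂ) * P u)‖ := norm_sub_le _ _
    _ ≤ 1 / 2 * (6 * rhoQ M ^ s * (2 : ℝ) ^ n) + 1 / 2 * (6 * rhoQ M ^ s * (2 : ℝ) ^ n) := by
        rw [norm_mul, norm_mul, show ‖(1 / 2 : ℂ)‖ = 1 / 2 from by norm_num]
        gcongr
    _ = 6 * rhoQ M ^ s * (2 : ℝ) ^ n := by ring

/-- **The fibre count through characters** for an arbitrary statistic `V : {0,1}ⁿ → ℤ/M`: for a constant strategy `Y` and a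
residue `m`, `#{u : V(u) = m, WIN_Y(u)} ≤ θ₀·2ⁿ/M + E·2ⁿ` whenever `#WIN_Y ≤ θ₀·2ⁿ` and every twisted sum
`|Σ_u [WIN_Y(u)] e_M(j V(u))|` (`j ≠ 0`) is `≤ E·2ⁿ`. -/
theorem card_fibre_win_le_gen (c : ℕ) (Y : Finset (Fin (n + 1))) (V : (Fin n → Bool) → ZMod M) (m : ZMod M) {θ₀ E : ℝ}
    (hY : ((univ.filter fun u : Fin n → Bool => ringWinU c (fun g _ => decide (g ∈ Y)) u = true).card : ℝ) ≤
      θ₀ * (2 : ℝ) ^ n) (hE0 : 0 ≤ E)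
    (hE : ∀ j : ZMod M, j ≠ 0 → ‖∑ u : Fin n → Bool, (if ringWinU c (fun g _ => decide (g ∈ Y)) u = true then (1 : ℂ) else 0) *
      (ZMod.stdAddChar (j * V u) : ℂ)‖ ≤ E * (2 : ℝ) ^ n) :
    ((univ.filter fun u : Fin n → Bool =>
        ringWinU c (fun g _ => decide (g ∈ Y)) u = true ∧ V u = m).card : ℝ) ≤
      θ₀ * (2 : ℝ) ^ n / M + E * (2 : ℝ) ^ n := by
  classical
  set W : (Fin n → Bool) → Prop := fun u => ringWinU c (fun g _ => decide (g ∈ Y)) u = true with hW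
  have hMpos : (0 : ℝ) < M := by exact_mod_cast Nat.pos_of_ne_zero (NeZero.ne M)
  have hMC : (M : ℂ) ≠ 0 := by exact_mod_cast NeZero.ne M
  set T : ZMod M → ℂ := fun j => ∑ u : Fin n → Bool, (if W u then (1 : ℂ) else 0) *
    (ZMod.stdAddChar (j * V u) : ℂ) with hT
  have hcount : (((univ.filter fun u : Fin n → Bool => W u ∧ V u = m).card : ℕ) : ℂ) =
      ((M : ℂ))⁻¹ * ∑ j : ZMod M, (ZMod.stdAddChar (-(j * m)) : ℂ) * T j := by
    rw [Finset.natCast_card_filter]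
    have hu : ∀ u : Fin n → Bool, (if W u ∧ V u = m then (1 : ℂ) else 0) =
        (if W u then (1 : ℂ) else 0) * (((M : ℂ))⁻¹ * ∑ j : ZMod M, (ZMod.stdAddChar (j * (V u - m)) : ℂ)) := by
      intro u
      rw [← indicator_eq_char_sum (V u - m)]
      by_cases h1 : W u <;> by_cases h2 : V u = m <;> simp [h1, h2, sub_eq_zero]
    simp_rw [hu]
    have hswap : (∑ u : Fin n → Bool, (if W u then (1 : ℂ) else 0) *
        (((M : ℂ))⁻¹ * ∑ j : ZMod M, (ZMod.stdAddChar (j * (V u - m)) : ℂ))) =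
        ((M : ℂ))⁻¹ * ∑ j : ZMod M, ∑ u : Fin n → Bool, (if W u then (1 : ℂ) else 0) *
          (ZMod.stdAddChar (j * (V u - m)) : ℂ) := by
      rw [Finset.sum_comm, Finset.mul_sum]
      refine Finset.sum_congr rfl fun u _ => ?_
      rw [Finset.mul_sum, Finset.mul_sum, Finset.mul_sum]
      refine Finset.sum_congr rfl fun j _ => ?_
      ring
    rw [hswap]
    congr 1
    refine Finset.sum_congr rfl fun j _ => ?_
    rw [hT, Finset.mul_sum]
    refine Finset.sum_congr rfl fun u _ => ?_
    rw [mul_sub, sub_eq_add_neg, AddChar.map_add_eq_mul]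
    ring
  have hT0 : ‖T 0‖ ≤ θ₀ * (2 : ℝ) ^ n := by
    have h0 : T 0 = (((univ.filter fun u : Fin n → Bool => W u).card : ℕ) : ℂ) := by
      rw [hT, Finset.natCast_card_filter]
      refine Finset.sum_congr rfl fun u _ => ?_
      rw [zero_mul, AddChar.map_zero_eq_one, mul_one]
    rw [h0, Complex.norm_natCast]
    exact hY
  have hTall : ∀ j : ZMod M, ‖(ZMod.stdAddChar (-(j * m)) : ℂ) * T j‖ ≤
      (if j = 0 then θ₀ * (2 : ℝ) ^ n else 0) + E * (2 : ℝ) ^ n := by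
    intro j
    rw [norm_mul, ZMod.stdAddChar_apply, Circle.norm_coe, one_mul]
    have hEn : 0 ≤ E * (2 : ℝ) ^ n := by positivity
    by_cases hj : j = 0
    · rw [if_pos hj, hj]; linarith
    · rw [if_neg hj]; linarith [hE j hj]
  have hsum : ‖∑ j : ZMod M, (ZMod.stdAddChar (-(j * m)) : ℂ) * T j‖ ≤ θ₀ * (2 : ℝ) ^ n + M * (E * (2 : ℝ) ^ n) := by
    refine (norm_sum_le _ _).trans ?_
    refine (Finset.sum_le_sum fun j _ => hTall j).trans ?_
    rw [Finset.sum_add_distrib, Finset.sum_ite_eq' univ (0 : ZMod M), if_pos (Finset.mem_univ _),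
      Finset.sum_const, Finset.card_univ, ZMod.card M, nsmul_eq_mul]
  have hreal : (((univ.filter fun u : Fin n → Bool => W u ∧ V u = m).card : ℕ) : ℝ) =
      ‖(((univ.filter fun u : Fin n → Bool => W u ∧ V u = m).card : ℕ) : ℂ)‖ := by
    rw [Complex.norm_natCast]
  rw [hreal, hcount, norm_mul, norm_inv, Complex.norm_natCast]
  calc (M : ℝ)⁻¹ * ‖∑ j : ZMod M, (ZMod.stdAddChar (-(j * m)) : ℂ) * T j‖
      ≤ (M : ℝ)⁻¹ * (θ₀ * (2 : ℝ) ^ n + M * (E * (2 : ℝ) ^ n)) :=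
        mul_le_mul_of_nonneg_left hsum (by positivity)
    _ = θ₀ * (2 : ℝ) ^ n / M + E * (2 : ℝ) ^ n := by
        field_simp

/-- The constant strategy played on the fibre `V(u) = m`. -/
def fibreT (tab : Fin (n + 1) → ZMod M → Bool) (m : ZMod M) : Finset (Fin (n + 1)) := univ.filter fun g => tab g m = true

omit [NeZero M] in
/-- On the fibre `V(u) = m` a table strategy IS the constant strategy `fibreT tab m`. -/
theorem ringWinU_tab_fibre (c : ℕ) (V : (Fin n → Bool) → ZMod M) (tab : Fin (n + 1) → ZMod M → Bool)
    {u : Fin n → Bool} {m : ZMod M} (hu : V u = m) :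
    ringWinU c (fun g u => tab g (V u)) u = ringWinU c (fun g _ => decide (g ∈ fibreT tab m)) u := by
  have h : ∀ g : Fin (n + 1), tab g (V u) = decide (g ∈ fibreT tab m) := fun g => by
    unfold fibreT
    rw [hu]
    simp
  unfold ringWinU
  simp only [h]

/-- **MAIN EXPANSION (one statistic).**  `#WIN(tab ∘ V) ≤ (θ₀ + M·E)·2ⁿ`. -/
theorem card_win_tab_le_of (c : ℕ) {θ₀ E : ℝ}
    (hconst : ∀ Y : Finset (Fin (n + 1)),
      ((univ.filter fun u : Fin n → Bool => ringWinU c (fun g _ => decide (g ∈ Y)) u = true).card : ℝ) ≤ θ₀ * (2 : ℝ) ^ n)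
    (hE0 : 0 ≤ E) (V : (Fin n → Bool) → ZMod M)
    (hE : ∀ Y : Finset (Fin (n + 1)), ∀ j : ZMod M, j ≠ 0 →
      ‖∑ u : Fin n → Bool, (if ringWinU c (fun g _ => decide (g ∈ Y)) u = true then (1 : ℂ) else 0) *
        (ZMod.stdAddChar (j * V u) : ℂ)‖ ≤ E * (2 : ℝ) ^ n)
    (tab : Fin (n + 1) → ZMod M → Bool) :
    ((univ.filter fun u : Fin n → Bool => ringWinU c (fun g u => tab g (V u)) u = true).card : ℝ) ≤
      (θ₀ + M * E) * (2 : ℝ) ^ n := by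
  classical
  have hsplit := Finset.card_eq_sum_card_fiberwise (f := V) (s := univ.filter fun u : Fin n → Bool =>
    ringWinU c (fun g u => tab g (V u)) u = true) (t := (univ : Finset (ZMod M))) (fun _ _ => Finset.mem_univ _)
  have hfib : ∀ m : ZMod M, ((univ.filter fun u : Fin n → Bool => ringWinU c (fun g u => tab g (V u)) u = true).filter
      fun u => V u = m) = univ.filter fun u : Fin n → Bool =>
        ringWinU c (fun g _ => decide (g ∈ fibreT tab m)) u = true ∧ V u = m := by
    intro m
    rw [Finset.filter_filter]
    refine Finset.filter_congr fun u _ => ?_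
    constructor
    · rintro ⟨hw, hm⟩; exact ⟨(ringWinU_tab_fibre c V tab hm) ▸ hw, hm⟩
    · rintro ⟨hw, hm⟩; exact ⟨(ringWinU_tab_fibre c V tab hm).symm ▸ hw, hm⟩
  rw [hsplit]
  push_cast
  calc (∑ m : ZMod M, ((((univ.filter fun u : Fin n → Bool => ringWinU c (fun g u => tab g (V u)) u = true).filter
          fun u => V u = m).card : ℕ) : ℝ))
      ≤ ∑ m : ZMod M, (θ₀ * (2 : ℝ) ^ n / M + E * (2 : ℝ) ^ n) := by
        refine Finset.sum_le_sum fun m _ => ?_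
        rw [hfib m]
        exact card_fibre_win_le_gen c (fibreT tab m) V m (hconst _) hE0 (hE _)
    _ = (θ₀ + M * E) * (2 : ℝ) ^ n := by
        rw [Finset.sum_const, Finset.card_univ, ZMod.card M, nsmul_eq_mul]
        have hM : (M : ℝ) ≠ 0 := by exact_mod_cast NeZero.ne M
        field_simp

/-- **MAIN THEOREM (finite, field-free, every modulus).**  For every `M ≥ 1`, `n ≥ 4`, every charge, every coefficient vectors
`q, l ∈ (ℤ/M)ⁿ`, every tables, and every `s` such that each non-zero multiple `j·q` has at least `s` non-zero coordinates,
`#WIN(qStrat q l tab) ≤ (3/4 + 6M·ρ_M^s)·2ⁿ`, `ρ_M = ((1 + cos(π/M))/2)^{1/2} < 1`. -/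
theorem qStrat_card_win_le (hn : 4 ≤ n) (c : ℕ) (q l : Fin n → ZMod M) (tab : Fin (n + 1) → ZMod M → Bool) {s : ℕ}
    (hs : ∀ j : ZMod M, j ≠ 0 → s ≤ (univ.filter fun i : Fin n => j * q i ≠ 0).card) :
    ((univ.filter fun u : Fin n → Bool => ringWinU c (qStrat q l tab) u = true).card : ℝ) ≤
      (3 / 4 + 6 * M * rhoQ M ^ s) * (2 : ℝ) ^ n := by
  have hρ0 := rhoQ_nonneg M
  have hρ1 := (rhoQ_lt_one M).le
  have h := card_win_tab_le_of (M := M) c (θ₀ := 3 / 4) (E := 6 * rhoQ M ^ s) (fun Y => ?_) (by positivity) (quadChain q l)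
    (fun Y j hj => ?_) tab
  · calc ((univ.filter fun u : Fin n → Bool => ringWinU c (qStrat q l tab) u = true).card : ℝ)
        = ((univ.filter fun u : Fin n → Bool => ringWinU c (fun g u => tab g (quadChain q l u)) u = true).card : ℝ) := rfl
      _ ≤ (3 / 4 + M * (6 * rhoQ M ^ s)) * (2 : ℝ) ^ n := h
      _ = (3 / 4 + 6 * M * rhoQ M ^ s) * (2 : ℝ) ^ n := by ring
  · exact hiddenCoinsFour n c (∅ : Finset (Fin n)) (by simp; omega) (fun g _ => decide (g ∈ Y)) (fun _ _ _ _ => rfl)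
  · refine (corr_win_quad_le c Y j q l).trans ?_
    have hpow : rhoQ M ^ (univ.filter fun i : Fin n => j * q i ≠ 0).card ≤ rhoQ M ^ s :=
      pow_le_pow_of_le_one hρ0 hρ1 (hs j hj)
    have h2n : (0 : ℝ) ≤ (2 : ℝ) ^ n := by positivity
    nlinarith

/-- The number of contracting sites needed: `6M·ρ_M^s ≤ 1/8` for all `s ≥ s₀(M)`. -/
theorem exists_quad_threshold (M : ℕ) [NeZero M] : ∃ s₀ : ℕ, ∀ s ≥ s₀, 6 * (M : ℝ) * rhoQ M ^ s ≤ 1 / 8 := by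
  have hMpos : (0 : ℝ) < M := by exact_mod_cast Nat.pos_of_ne_zero (NeZero.ne M)
  obtain ⟨s₀, hs₀⟩ := exists_pow_lt_of_lt_one (show (0 : ℝ) < 1 / (48 * M) from div_pos one_pos (by linarith)) (rhoQ_lt_one M)
  refine ⟨s₀, fun s hs => ?_⟩
  have h1 : rhoQ M ^ s ≤ rhoQ M ^ s₀ := pow_le_pow_of_le_one (rhoQ_nonneg M) (rhoQ_lt_one M).le hs
  have h2 : rhoQ M ^ s₀ ≤ 1 / (48 * M) := hs₀.le
  calc 6 * (M : ℝ) * rhoQ M ^ s ≤ 6 * M * (1 / (48 * M)) := by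
        exact mul_le_mul_of_nonneg_left (h1.trans h2) (by positivity)
    _ = 1 / 8 := by field_simp; ring

/-- **THE MEMORY DIAL (asymptotic, every modulus; Prop-definition-free form of the node's `QuadChainHard`)**: for every
`M ≥ 1` there is `s₀` such that every quad-chain strategy mod `M` whose quadratic coefficient vector keeps `≥ s₀` non-zero
coordinates under every non-zero scaling wins the u-walk game on `≤ (7/8)·2ⁿ` inputs (`n ≥ 4`, every charge, every tables). -/
theorem qStrat_card_win_le_seven_eighths (M : ℕ) [NeZero M] :
    ∃ s₀ : ℕ, ∀ (n : ℕ) (c : ℕ) (q l : Fin n → ZMod M) (tab : Fin (n + 1) → ZMod M → Bool), 4 ≤ n →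
      (∀ j : ZMod M, j ≠ 0 → s₀ ≤ (univ.filter fun i : Fin n => j * q i ≠ 0).card) →
        ((univ.filter fun u : Fin n → Bool => ringWinU c (qStrat q l tab) u = true).card : ℝ) ≤ (7 / 8) * (2 : ℝ) ^ n := by
  obtain ⟨s₀, hs₀⟩ := exists_quad_threshold M
  refine ⟨s₀, fun n c q l tab hn hs => ?_⟩
  have h := qStrat_card_win_le hn c q l tab hs
  have h2n : (0 : ℝ) ≤ (2 : ℝ) ^ n := by positivity
  have := hs₀ s₀ le_rfl
  nlinarith

end QuadChain

end Summit.QuantumAdvantage.QuantumAdvantage.Theorems.DigitDial
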